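import Summits.AtomisticToContinuum.Crystallization.Theorems.FrustratedLawDichotomyStrainedPatchRecutRecord

/-!
# The RECUT CHARTS THE CLUSTER: the coarse `τ₁ = 7/20` chart of (RFᴿ) through the skeleton, proved
# (27623 strained-patch piece, T-side [CORE-FAR]; decomp-a2c lens-5 «RecutPairs», generation 54, step (R5))

(Imports `…RecutRecord` for the pinned chart family `𝓘₀ᴿʷ = ChartFamilyRW`; `…RecutBuild` through it.)  `…RecutBuild` built the recut instance
`z₁ = y + b₁ ∘ w` of a presented chart `z₀` (skeleton `w` of the recut window, conjugate bend `b₁`).  This module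
proves the CHART clause of (RFᴿ) = `AffineRecut`: if `z₀` charts the cluster `z` (coarse `τ₀ = 1/4`, labels `e₀`, `ChartBy 𝓘₀ τ₀ t`), then `z₁` charts it
coarsely with `τ₁ = 7/20` through the RELABELLING `e₁ a :=` the skeleton index of `(1+A)·σ(e₀ a)`, `σ(k)` = the chart's skeleton vector of index `k`:

* centre to centre; coarse (and `t := τ₁` fine) deviation `≤ 1/4 + ‖A‖·(63/10 + 1/4) ≤ 1/4 + 6.55/150 ≤ 7/20`, because `z₁ (e₁ a) − z₁ c₁ = (1+A)(z₀ (e₀ a) − z₀ c₀)`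
  (conjugacy) — the label IS in the recut window by the inverse-bend bootstrap `‖σ‖ ≤ ‖b₀ σ‖ + (133/10)²/200 + (133/10)³/2000 ≤ 6.55 + 2.1`, `(1 + 1/150)·8.65 ≤ 133/10`;
* injective on the ball (`1+A` injective, `z₀` injective, `e₀` injective on the ball);
* covering the instance's `(63/10 − 7/20)`-ball: a recut site within `5.95` of the centre is `(1+A)(b₀ u)` with `‖b₀ u‖ ≤ 5.95·150/149 ≤ 63/10 − 1/4`, `u` a chart
  skeleton vector (`‖u‖ ≤ 5.99 + 2.15 ≤ 133/10`), hence the image of a chart site covered by `e₀`.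
Membership of `z₁` in the comparison family is the hypothesis `hmem` ((R7): the `η₃₀`-goodness of the recut centre, census KAPPA-N; `…RecutBuild.compFamilyW_recut`).
★ `chartBy_recut` (generic families `𝓘₀`, `𝓘₁`, explicit `e₁`), ★★ `exists_chart_recut_of_chartFamilyRW` (pinned: every `𝓘₀ᴿʷ`-charted cluster and every
`‖A‖ ≤ κL₀·t` yield a recut `RecutOf A …` that is `RecutNear`, injective, separated, `𝓑₁`-bent and — once its centre is `η₃₀`-good — CHARTS THE CLUSTER in `𝓘₁ʷ`
with `τ₁`), and the SPLIT OF (RFᴿ-bentW): ★ `RecutLSWith κN` / `RecutLSW` = its least-squares half ((R1) `‖A_LS‖ ≤ κL₀·t` + `projectedFree`, (R6) `LevelNear κN`, (R7) the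
goodness — for every recut OF the matrix; level constant `κN` a parameter, restated `κN♯ = 9/10 =: kN2` after census KAPPA-N♭), ★★★ `affineRecut_of_LS :
RecutLSWith κN → AffineRecut 𝓘₀ᴿʷ 𝓘₁ʷ 𝓑₀ τ₀ τ₁ κN κL₀ T₀` (the instance half is PROVED; `recutBentW_of_LS` at the record's `κN₁ = 1/3`, `affineRecutW_of_LSW` at `κN♯`).
No sorry, no new axioms, no cite tokens, no instances / notation.  `--supports stmt-AtomisticToContinuum-27623`.
-/

noncomputable section

namespace Summit.AtomisticToContinuum.Crystallization.Theorems.FrustratedLawDichotomyStrainedPatchRecutChart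

open scoped BigOperators Classical
open Summit.AtomisticToContinuum.Crystallization.Theorems.FrustratedLawDichotomyPeriodicBlockFlags (goodAtScale_mono)
open Summit.AtomisticToContinuum.Crystallization.Theorems.FrustratedLawDichotomyRangeCut (Sep)
open Summit.AtomisticToContinuum.Crystallization.Theorems.FrustratedLawDichotomyMotifLemmas
open Summit.AtomisticToContinuum.Crystallization.Theorems.FrustratedLawDichotomyAveragingCut
open Summit.AtomisticToContinuum.Crystallization.Theorems.FrustratedLawDichotomyAveragingRuleCap
open Summit.AtomisticToContinuum.Crystallization.Theorems.FrustratedLawDichotomyAveragingRuleTightFree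
open Summit.AtomisticToContinuum.Crystallization.Theorems.FrustratedLawDichotomyExemptDoor (SitePred)
open Summit.AtomisticToContinuum.Crystallization.Theorems.FrustratedLawDichotomyExemptAbsorption
open Summit.AtomisticToContinuum.Crystallization.Theorems.FrustratedLawDichotomyExemptAbsorptionRecord
open Summit.AtomisticToContinuum.Crystallization.Theorems.FrustratedLawDichotomyCollarCensus
open Summit.AtomisticToContinuum.Crystallization.Theorems.FrustratedLawDichotomyCollarCensusKappa
open Summit.AtomisticToContinuum.Crystallization.Theorems.FrustratedLawDichotomyStrainedPatchHomSplit
open Summit.AtomisticToContinuum.Crystallization.Theorems.FrustratedLawDichotomyStrainedPatchCleanCollar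
open Summit.AtomisticToContinuum.Crystallization.Theorems.FrustratedLawDichotomyStrainedPatchHomTube
open Summit.AtomisticToContinuum.Crystallization.Theorems.FrustratedLawDichotomyStrainedPatchHomIsometry
open Summit.AtomisticToContinuum.Crystallization.Theorems.FrustratedLawDichotomyStrainedPatchHomTubeIso
open Summit.AtomisticToContinuum.Crystallization.Theorems.FrustratedLawDichotomyStrainedPatchPhaseCut
open Summit.AtomisticToContinuum.Crystallization.Theorems.FrustratedLawDichotomyStrainedPatchCoreTube
open Summit.AtomisticToContinuum.Crystallization.Theorems.FrustratedLawDichotomyStrainedPatchCoreTubeRecord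
open Summit.AtomisticToContinuum.Crystallization.Theorems.FrustratedLawDichotomyStrainedPatchCoreTubeMilli
open Summit.AtomisticToContinuum.Crystallization.Theorems.FrustratedLawDichotomyStrainedPatchStrainBands
open Summit.AtomisticToContinuum.Crystallization.Theorems.FrustratedLawDichotomyStrainedPatchChartFamilies
open Summit.AtomisticToContinuum.Crystallization.Theorems.FrustratedLawDichotomyStrainedPatchChartFamiliesBent
open Summit.AtomisticToContinuum.Crystallization.Theorems.FrustratedLawDichotomyStrainedPatchChartFamiliesPinned
open Summit.AtomisticToContinuum.Crystallization.Theorems.FrustratedLawDichotomyStrainedPatchEnvelopeLaw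
open Summit.AtomisticToContinuum.Crystallization.Theorems.FrustratedLawDichotomyStrainedPatchEnvelopeTaylor
open Literature.Barriers.AtomisticToContinuum.FlatleyTheil2015 (fccVec)
open Summit.AtomisticToContinuum.Crystallization.Theorems.FrustratedLawDichotomyStrainedPatchRecutPairs
open Summit.AtomisticToContinuum.Crystallization.Theorems.FrustratedLawDichotomyStrainedPatchRecutKinematics
open Literature.Barriers.AtomisticToContinuum.FlatleyTheil2015 (fccPoint)
open Summit.AtomisticToContinuum.Crystallization.Theorems.FrustratedLawDichotomyStrainedPatchHomRelief (latPt_fccVec_eq)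
open Summit.AtomisticToContinuum.Crystallization.Theorems.FrustratedLawDichotomyStrainedPatchHomLatticeBox (norm_apply_ge_of_near_one latPt_zero
  mem_box_of_norm_fccPoint_lt)
open Summit.AtomisticToContinuum.Crystallization.Theorems.FrustratedLawDichotomyStrainedPatchHomLatticeBoxHcp (latPt_eq_apply_one shifted_eq_apply)
open Summit.AtomisticToContinuum.Crystallization.Theorems.FrustratedLawDichotomyStrainedPatchHomLatticeBoxWindow (mem_box_of_norm_hexPt_lt'
  mem_box_of_norm_hexPt_add_shift_lt')
open Summit.AtomisticToContinuum.Crystallization.Theorems.FrustratedLawDichotomyStrainedPatchWindowFamilies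
open Summit.AtomisticToContinuum.Crystallization.Theorems.FrustratedLawDichotomyStrainedPatchRecutBuild
open Summit.AtomisticToContinuum.Crystallization.Theorems.FrustratedLawDichotomyStrainedPatchRecutRecord

/-! ## §1. The inverse-bend bootstrap and two operator-norm facts -/

/-- `‖b v − v‖ ≤ q₂‖v‖² + q₃‖v‖³` for a polynomial bend. [formal bookkeeping] -/
theorem norm_polyBend_sub_le {q₂ q₃ : ℝ} {b : E3 → E3} (hb : b ∈ polyBends q₂ q₃) (v : E3) : ‖b v - v‖ ≤ q₂ * ‖v‖ ^ 2 + q₃ * ‖v‖ ^ 3 := by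
  obtain ⟨Q, C, hQ, hC, hb⟩ := hb
  rw [hb v, add_assoc, add_sub_cancel_left]
  have h1 : ‖Q v v‖ ≤ q₂ * ‖v‖ ^ 2 := by rw [sq, ← mul_assoc]; exact hQ v v
  have h2 : ‖C v v v‖ ≤ q₃ * ‖v‖ ^ 3 := by
    calc ‖C v v v‖ ≤ q₃ * ‖v‖ * ‖v‖ * ‖v‖ := hC v v v
      _ = q₃ * ‖v‖ ^ 3 := by ring
  exact (norm_add_le _ _).trans (add_le_add h1 h2)

/-- ★ **INVERSE-BEND BOOTSTRAP** — a skeleton vector of norm `≤ R₁` is within `q₂R₁² + q₃R₁³` of its bent image in norm: `‖v‖ ≤ ‖b v‖ + q₂R₁² + q₃R₁³`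
(`0 ≤ q₂, q₃`). [formal bookkeeping] -/
theorem norm_le_of_polyBend {q₂ q₃ : ℝ} {b : E3 → E3} (hb : b ∈ polyBends q₂ q₃) (hq₂ : 0 ≤ q₂) (hq₃ : 0 ≤ q₃) {v : E3} {R₁ : ℝ} (hv : ‖v‖ ≤ R₁) :
    ‖v‖ ≤ ‖b v‖ + q₂ * R₁ ^ 2 + q₃ * R₁ ^ 3 := by
  have h0 : 0 ≤ ‖v‖ := norm_nonneg v
  have h2 : ‖v‖ ^ 2 ≤ R₁ ^ 2 := pow_le_pow_left₀ h0 hv 2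
  have h3 : ‖v‖ ^ 3 ≤ R₁ ^ 3 := pow_le_pow_left₀ h0 hv 3
  have hsub := norm_polyBend_sub_le hb v
  have htri : ‖v‖ ≤ ‖b v‖ + ‖b v - v‖ := by
    have h := norm_sub_le (b v) (b v - v)
    rwa [sub_sub_cancel] at h
  nlinarith [mul_le_mul_of_nonneg_left h2 hq₂, mul_le_mul_of_nonneg_left h3 hq₃]

/-- The bootstrap for `𝓑₀` on the chart window: `‖v‖ ≤ 133/10 ⟹ ‖v‖ ≤ ‖b v‖ + 21/10`. [formal bookkeeping] -/
theorem norm_le_of_bends0_window {b : E3 → E3} (hb : b ∈ bends0) {v : E3} (hv : ‖v‖ ≤ 133 / 10) : ‖v‖ ≤ ‖b v‖ + 21 / 10 := by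
  have h := norm_le_of_polyBend (q₂ := 1 / 200) (q₃ := 1 / 2000) (by simpa [bends0] using hb) (by norm_num) (by norm_num) hv
  have : (1 / 200 : ℝ) * (133 / 10) ^ 2 + 1 / 2000 * (133 / 10) ^ 3 ≤ 21 / 10 := by norm_num
  linarith

/-- The bootstrap for `𝓑₀` on the skeleton window of the recut: `‖v‖ ≤ 27/2 ⟹ ‖v‖ ≤ ‖b v‖ + 43/20`. [formal bookkeeping] -/
theorem norm_le_of_bends0_window' {b : E3 → E3} (hb : b ∈ bends0) {v : E3} (hv : ‖v‖ ≤ 27 / 2) : ‖v‖ ≤ ‖b v‖ + 43 / 20 := by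
  have h := norm_le_of_polyBend (q₂ := 1 / 200) (q₃ := 1 / 2000) (by simpa [bends0] using hb) (by norm_num) (by norm_num) hv
  have : (1 / 200 : ℝ) * (27 / 2) ^ 2 + 1 / 2000 * (27 / 2) ^ 3 ≤ 43 / 20 := by norm_num
  linarith

/-- `(1+A) q = q + A q`, so `dist q ((1+A) q) = ‖A q‖ ≤ ‖A‖·‖q‖`. [formal bookkeeping] -/
theorem dist_one_add_apply_le (A : E3 →L[ℝ] E3) (q : E3) : dist q (((1 : E3 →L[ℝ] E3) + A) q) ≤ ‖A‖ * ‖q‖ := by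
  have h : ((1 : E3 →L[ℝ] E3) + A) q = q + A q := by simp only [add_apply, one_apply_eq_self]
  rw [h, dist_eq_norm, sub_add_cancel_left, norm_neg]
  exact A.le_opNorm q

/-- `1 + A` is injective for `‖A‖ ≤ 1/150`. [formal bookkeeping] -/
theorem one_add_injective (A : E3 →L[ℝ] E3) (hA : ‖A‖ ≤ 1 / 150) {u v : E3} (h : ((1 : E3 →L[ℝ] E3) + A) u = ((1 : E3 →L[ℝ] E3) + A) v) :
    u = v := by
  have hal := antilipschitz_one_add A hA (u - v)
  rw [map_sub, h, sub_self, norm_zero] at hal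
  have h0 : ‖u - v‖ ≤ 0 := by nlinarith [norm_nonneg (u - v)]
  exact sub_eq_zero.1 (norm_le_zero_iff.1 h0)

/-! ## §2. The relabelling through the skeleton -/

open Classical in
/-- **`idxOf w c₁ x`** — the index of the point `x` in the enumeration `w` (the junk index `c₁` off its range). -/
def idxOf {M₁ : ℕ} (w : Fin M₁ → E3) (c₁ : Fin M₁) (x : E3) : Fin M₁ :=
  if h : ∃ j, w j = x then h.choose else c₁

/-- On the range, `w (idxOf w c₁ x) = x`. [formal bookkeeping] -/
theorem apply_idxOf {M₁ : ℕ} {w : Fin M₁ → E3} (c₁ : Fin M₁) {x : E3} (h : ∃ j, w j = x) : w (idxOf w c₁ x) = x := by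
  simp only [idxOf, dif_pos h]
  exact h.choose_spec

/-- For an injective enumeration, `idxOf` returns THE index. [formal bookkeeping] -/
theorem idxOf_eq {M₁ : ℕ} {w : Fin M₁ → E3} (hinj : Function.Injective w) (c₁ : Fin M₁) {x : E3} {j : Fin M₁} (hj : w j = x) :
    idxOf w c₁ x = j :=
  hinj (by rw [apply_idxOf c₁ ⟨j, hj⟩, hj])

/-! ## §3. ★ The recut charts the cluster (coarse `τ₁ = 7/20`) -/

/-- The two pinned inequalities of the coarse chart: deviation `1/4 + (1/150)(63/10 + 1/4) ≤ 7/20` and covering `(63/10 − 7/20)/(1 − 1/150) ≤ 63/10 − 1/4`.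
[formal bookkeeping] -/
theorem tau1_arith : tau0 + 1 / 150 * (63 / 10 + tau0) ≤ tau1 ∧ (63 / 10 - tau1) ≤ (1 - 1 / 150) * (63 / 10 - tau0) := by
  simp only [tau0, tau1]; norm_num

/-- ★★ **THE RECUT CHARTS THE CLUSTER** — data: a chart `z₀` of the cluster `z` (`ChartBy 𝓘₀ τ₀ t … e₀`, `z₀` injective) PRESENTED through a skeleton
`s` (`range s` = the homogeneous `133/10`-ball about `s c₀`, `z₀ k − z₀ c₀ = b₀ (s k − s c₀)`, `b₀ ∈ 𝓑₀`); a matrix `‖A‖ ≤ 1/150`; a bend `b₁` with `b₁ 0 = 0`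
conjugate to `b₀` (`b₁ ∘ (1+A) = (1+A) ∘ b₀`); an injective skeleton `w` of the recut window (`latSet φ ((1+A)G) ξ`, norm `≤ 133/10`, `w c₁ = 0`).  Conclusion:
the recut instance `j ↦ y + b₁ (w j)` — if it lies in `𝓘₁` — charts `z` with coarse (and fine) modulus `τ₁ = 7/20` through `e₁ a := idxOf w c₁ ((1+A)(s (e₀ a) − s c₀))`.
[folklore] -/
theorem chartBy_recut {𝓘₀ 𝓘₁ : (M₀ : ℕ) → (Fin M₀ → E3) → Fin M₀ → Prop} {M : ℕ} {z : Fin M → E3} {c : Fin M} {M₀ : ℕ} {z₀ : Fin M₀ → E3}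
    {c₀ : Fin M₀} {e₀ : Fin M → Fin M₀} {t : ℝ} (hch : ChartBy 𝓘₀ tau0 t z c z₀ c₀ e₀) (hinj₀ : Function.Injective z₀)
    {φ : Bool} {b₀ : E3 → E3} {G : E3 →L[ℝ] E3} {ξ : E3} (hb₀ : b₀ ∈ bends0) {s : Fin M₀ → E3}
    (hs : Set.range s = homRange φ G ξ (133 / 10) (s c₀)) (hzs : ∀ k, z₀ k - z₀ c₀ = b₀ (s k - s c₀))
    (A : E3 →L[ℝ] E3) (hA : ‖A‖ ≤ 1 / 150) {b₁ : E3 → E3} (hb₁0 : b₁ 0 = 0)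
    (hconj : ∀ v, b₁ (((1 : E3 →L[ℝ] E3) + A) v) = ((1 : E3 →L[ℝ] E3) + A) (b₀ v)) {M₁ : ℕ} {w : Fin M₁ → E3} {c₁ : Fin M₁}
    (hwinj : Function.Injective w) (hwr : Set.range w = {u : E3 | u ∈ latSet φ (((1 : E3 →L[ℝ] E3) + A) * G) ξ ∧ ‖u‖ ≤ 133 / 10}) (hwc : w c₁ = 0)
    (y : E3) (hmem : 𝓘₁ M₁ (fun j => y + b₁ (w j)) c₁) :
    ChartBy 𝓘₁ tau1 tau1 z c (fun j => y + b₁ (w j)) c₁ (fun a => idxOf w c₁ (((1 : E3 →L[ℝ] E3) + A) (s (e₀ a) - s c₀))) := by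
  obtain ⟨-, hec, hcoarse, -, heinj, hcov⟩ := hch
  have h149 : (0 : ℝ) < 1 - 1 / 150 := by norm_num
  -- the chart's skeleton vectors
  have hσ : ∀ k, s k - s c₀ ∈ latSet φ G ξ ∧ ‖s k - s c₀‖ ≤ 133 / 10 := by
    intro k
    have hk : s k ∈ homRange φ G ξ (133 / 10) (s c₀) := hs ▸ ⟨k, rfl⟩
    rw [mem_homRange_iff, dist_eq_norm] at hk
    exact ⟨hk.2, hk.1⟩
  -- a skeleton vector whose bent image is short is a recut-window label
  have hwin : ∀ k, ‖b₀ (s k - s c₀)‖ ≤ 63 / 10 + tau0 → ∃ j, w j = ((1 : E3 →L[ℝ] E3) + A) (s k - s c₀) := by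
    intro k hk
    have hmem' : ((1 : E3 →L[ℝ] E3) + A) (s k - s c₀) ∈ Set.range w := by
      rw [hwr]
      refine ⟨?_, ?_⟩
      · rw [latSet_mul]; exact ⟨s k - s c₀, (hσ k).1, rfl⟩
      · have hb := norm_le_of_bends0_window hb₀ (hσ k).2
        have h1A := norm_one_add_le A hA
        have happ := (((1 : E3 →L[ℝ] E3) + A).le_opNorm (s k - s c₀))
        have : ‖((1 : E3 →L[ℝ] E3) + A)‖ * ‖s k - s c₀‖ ≤ (1 + 1 / 150) * (63 / 10 + tau0 + 21 / 10) :=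
          mul_le_mul h1A (by linarith) (norm_nonneg _) (by norm_num)
        simp only [tau0] at this ⊢
        linarith
    exact hmem'
  -- the bent image of the chart label of a ball site is short
  have hshort : ∀ a, dist (z a) (z c) ≤ 63 / 10 → ‖b₀ (s (e₀ a) - s c₀)‖ ≤ 63 / 10 + tau0 := by
    intro a ha
    have hd := hcoarse a ha
    rw [hzs] at hd
    have htri : ‖b₀ (s (e₀ a) - s c₀)‖ ≤ ‖z a - z c‖ + dist (z a - z c) (b₀ (s (e₀ a) - s c₀)) := by
      rw [dist_eq_norm]
      calc ‖b₀ (s (e₀ a) - s c₀)‖ = ‖(z a - z c) - ((z a - z c) - b₀ (s (e₀ a) - s c₀))‖ := by rw [sub_sub_cancel]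
        _ ≤ ‖z a - z c‖ + ‖(z a - z c) - b₀ (s (e₀ a) - s c₀)‖ := norm_sub_le _ _
    have hp : ‖z a - z c‖ ≤ 63 / 10 := by rw [← dist_eq_norm]; exact ha
    linarith
  -- the relabelled site difference is `(1+A)` of the chart site difference
  have hdiff : ∀ a, dist (z a) (z c) ≤ 63 / 10 →
      (y + b₁ (w (idxOf w c₁ (((1 : E3 →L[ℝ] E3) + A) (s (e₀ a) - s c₀))))) - (y + b₁ (w c₁)) =
        ((1 : E3 →L[ℝ] E3) + A) (z₀ (e₀ a) - z₀ c₀) := by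
    intro a ha
    rw [apply_idxOf c₁ (hwin (e₀ a) (hshort a ha)), hconj, hwc, hb₁0, add_zero, add_sub_cancel_left, hzs]
  have hdev : ∀ a, dist (z a) (z c) ≤ 63 / 10 →
      dist (z a - z c) ((y + b₁ (w (idxOf w c₁ (((1 : E3 →L[ℝ] E3) + A) (s (e₀ a) - s c₀))))) - (y + b₁ (w c₁))) ≤ tau1 := by
    intro a ha
    rw [hdiff a ha]
    have hd := hcoarse a ha
    have hq : ‖z₀ (e₀ a) - z₀ c₀‖ ≤ 63 / 10 + tau0 := by rw [hzs]; exact hshort a ha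
    have hAq : dist (z₀ (e₀ a) - z₀ c₀) (((1 : E3 →L[ℝ] E3) + A) (z₀ (e₀ a) - z₀ c₀)) ≤ 1 / 150 * (63 / 10 + tau0) :=
      (dist_one_add_apply_le A _).trans (mul_le_mul hA hq (norm_nonneg _) (by norm_num))
    have htri := dist_triangle (z a - z c) (z₀ (e₀ a) - z₀ c₀) (((1 : E3 →L[ℝ] E3) + A) (z₀ (e₀ a) - z₀ c₀))
    linarith [tau1_arith.1]
  refine ⟨hmem, ?_, hdev, fun a ha _ => hdev a ha, ?_, ?_⟩
  · -- centre to centre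
    refine idxOf_eq hwinj c₁ ?_
    rw [hec, sub_self, map_zero, hwc]
  · -- injective on the ball
    intro a b ha hb hab
    have hwa := apply_idxOf c₁ (hwin (e₀ a) (hshort a ha))
    have hwb := apply_idxOf c₁ (hwin (e₀ b) (hshort b hb))
    have hab' : idxOf w c₁ (((1 : E3 →L[ℝ] E3) + A) (s (e₀ a) - s c₀)) = idxOf w c₁ (((1 : E3 →L[ℝ] E3) + A) (s (e₀ b) - s c₀)) := hab
    rw [hab'] at hwa
    have hσab : s (e₀ a) - s c₀ = s (e₀ b) - s c₀ := one_add_injective A hA (hwa.symm.trans hwb)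
    have hz : z₀ (e₀ a) = z₀ (e₀ b) := by
      have h := hzs (e₀ a)
      rw [hσab, ← hzs (e₀ b)] at h
      exact sub_left_injective h
    exact heinj a b ha hb (hinj₀ hz)
  · -- covering the instance's (63/10 − τ₁)-ball
    intro j₁ hj₁
    have hwj : w j₁ ∈ Set.range w := ⟨j₁, rfl⟩
    rw [hwr] at hwj
    obtain ⟨hlat, hnorm⟩ := hwj
    rw [latSet_mul] at hlat
    obtain ⟨u, hu, huj⟩ := hlat
    have hu27 : ‖u‖ ≤ 27 / 2 := norm_le_window A hA (by rw [huj]; exact hnorm)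
    have hz₁ : (y + b₁ (w j₁)) - (y + b₁ (w c₁)) = ((1 : E3 →L[ℝ] E3) + A) (b₀ u) := by
      rw [hwc, hb₁0, add_zero, add_sub_cancel_left, ← huj, hconj]
    rw [dist_eq_norm, hz₁] at hj₁
    have hal := antilipschitz_one_add A hA (b₀ u)
    have hbu : ‖b₀ u‖ ≤ 63 / 10 - tau0 := by
      have h2 := tau1_arith.2
      have h6 : (0 : ℝ) ≤ 63 / 10 - tau0 := by simp only [tau0]; norm_num
      nlinarith
    have hu13 : ‖u‖ ≤ 133 / 10 := by
      have h := norm_le_of_bends0_window' hb₀ hu27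
      simp only [tau0] at hbu
      linarith
    -- `s c₀ + u` is a chart skeleton point
    have hsu : s c₀ + u ∈ Set.range s := by
      rw [hs, mem_homRange_iff, dist_eq_norm, add_sub_cancel_left]
      exact ⟨hu13, hu⟩
    obtain ⟨k, hk⟩ := hsu
    have hσk : s k - s c₀ = u := by rw [hk, add_sub_cancel_left]
    have hdk : dist (z₀ k) (z₀ c₀) ≤ 63 / 10 - tau0 := by rw [dist_eq_norm, hzs, hσk]; exact hbu
    obtain ⟨a, ha, hea⟩ := hcov k hdk
    refine ⟨a, ha, ?_⟩
    show idxOf w c₁ (((1 : E3 →L[ℝ] E3) + A) (s (e₀ a) - s c₀)) = j₁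
    rw [hea, hσk]
    exact idxOf_eq hwinj c₁ huj.symm

/-! ## §4. Pinned: every `𝓘₀ᴿʷ`-charted cluster is charted by THE recut of a given matrix `A` (modulo the goodness of its centre); (RFᴿ-bentW) = its LEAST-SQUARES HALF -/

/-- **`RecutOf A z₀ c₀ z₁ c₁ e₀ e₁`** — `(z₁, c₁, e₁)` IS a recut of the chart `(z₀, c₀, e₀)` by the matrix `A`: a presentation `(φ, b₀ ∈ 𝓑₀, G, ξ)` of `z₀` through a
skeleton `s` (`range s` = the homogeneous `133/10`-ball about `s c₀`, `z₀ k − z₀ c₀ = b₀ (s k − s c₀)`), the conjugate bend `b₁ ∈ 𝓑₁` (`b₁ ∘ (1+A) = (1+A) ∘ b₀`),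
an injective skeleton `w` of the recut window (`latSet φ ((1+A)G) ξ`, norm `≤ 133/10`, `w c₁ = 0`) with `z₁ j = z₁ c₁ + b₁ (w j)`, and the labels
`e₁ a = idxOf w c₁ ((1+A)(s (e₀ a) − s c₀))`.  The object the least-squares half quantifies over. -/
def RecutOf (A : E3 →L[ℝ] E3) {M₀ : ℕ} (z₀ : Fin M₀ → E3) (c₀ : Fin M₀) {M₁ : ℕ} (z₁ : Fin M₁ → E3) (c₁ : Fin M₁) {M : ℕ} (e₀ : Fin M → Fin M₀)
    (e₁ : Fin M → Fin M₁) : Prop :=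
  ∃ (φ : Bool) (b₀ b₁ : E3 → E3) (G : E3 →L[ℝ] E3) (ξ : E3) (s : Fin M₀ → E3) (w : Fin M₁ → E3), b₀ ∈ bends0 ∧ b₁ ∈ bends1 ∧
    Set.range s = homRange φ G ξ (133 / 10) (s c₀) ∧ (∀ k, z₀ k - z₀ c₀ = b₀ (s k - s c₀)) ∧
    (∀ v, b₁ (((1 : E3 →L[ℝ] E3) + A) v) = ((1 : E3 →L[ℝ] E3) + A) (b₀ v)) ∧ Function.Injective w ∧
    Set.range w = {u : E3 | u ∈ latSet φ (((1 : E3 →L[ℝ] E3) + A) * G) ξ ∧ ‖u‖ ≤ 133 / 10} ∧ w c₁ = 0 ∧ (∀ j, z₁ j = z₁ c₁ + b₁ (w j)) ∧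
    ∀ a, e₁ a = idxOf w c₁ (((1 : E3 →L[ℝ] E3) + A) (s (e₀ a) - s c₀))

/-- ★★ **THE RECUT OF A CHARTED CLUSTER BY A GIVEN MATRIX** — for a cluster `z` charted by `z₀ ∈ 𝓘₀ᴿʷ` (`ChartBy 𝓘₀ᴿʷ (1/4) t … e₀`), every `0 ≤ t ≤ T₀(z₀)`,
every `‖A‖ ≤ κL₀·t` and every base point `y`: a recut `(z₁, c₁, e₁)` OF `A` (`RecutOf A …`) centred at `y`, `RecutNear 𝓑₀ κL₀ t`, `z₁` injective, separated,
`𝓑₁`-bent, and `GoodAtScale η₃₀ (3/2) z₁ c₁ → ChartBy 𝓘₁ʷ (7/20) (7/20) z c z₁ c₁ e₁`. [folklore] -/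
theorem exists_chart_recut_of_chartFamilyRW {M : ℕ} {z : Fin M → E3} {c : Fin M} {M₀ : ℕ} {z₀ : Fin M₀ → E3} {c₀ : Fin M₀} {e₀ : Fin M → Fin M₀}
    {t : ℝ} (hch : ChartBy ChartFamilyRW tau0 t z c z₀ c₀ e₀) (ht : 0 ≤ t) (ht' : t ≤ T0 M₀ z₀ c₀) (A : E3 →L[ℝ] E3) (hA : ‖A‖ ≤ kL0 * max t 0)
    (y : E3) :
    ∃ (M₁ : ℕ) (z₁ : Fin M₁ → E3) (c₁ : Fin M₁) (e₁ : Fin M → Fin M₁), RecutOf A z₀ c₀ z₁ c₁ e₀ e₁ ∧ z₁ c₁ = y ∧ RecutNear bends0 kL0 t z₀ c₀ z₁ c₁ ∧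
      Function.Injective z₁ ∧ Sep z₁ ∧ IsBentBall bends1 (133 / 10) z₁ c₁ ∧ (GoodAtScale eta30 (3 / 2) z₁ c₁ → ChartBy CompFamilyW tau1 tau1 z c z₁ c₁ e₁) := by
  have hI : ChartFamilyRW M₀ z₀ c₀ := hch.1
  have hinj₀ : Function.Injective z₀ := hI.1.1.1
  obtain ⟨φ, b₀, G, ξ, hb₀, hP₀, hG, hξ, hW⟩ := hI.2
  have ht60 : t ≤ 1 / 60 := ht'.trans (T0_le_of_goodAtScale hI.1.2.2)
  have hA' : ‖A‖ ≤ 1 / 150 := hA.trans (kL0_mul_le ht ht60)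
  obtain ⟨b₁, M₁, w, c₁, hb₁, hconj, hwinj, hwr, hwc, hP₁, hbent, hinj₁, hsep⟩ :=
    exists_recut hb₀ hG (hξ.trans (by norm_num [xi0])) (by simpa only [sep0] using hW) A hA' y
  have hb₁0 : b₁ 0 = 0 := polyBend_zero (q₂ := 11 / 2000) (q₃ := 11 / 20000) (by simpa [bends1] using hb₁)
  obtain ⟨-, -, s, hs, hzs⟩ := hP₀
  have hy : (fun j => y + b₁ (w j)) c₁ = y := by simp only [hwc, hb₁0, add_zero]
  refine ⟨M₁, fun j => y + b₁ (w j), c₁, fun a => idxOf w c₁ (((1 : E3 →L[ℝ] E3) + A) (s (e₀ a) - s c₀)),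
    ⟨φ, b₀, b₁, G, ξ, s, w, hb₀, hb₁, hs, hzs, hconj, hwinj, hwr, hwc, fun j => by rw [hy], fun a => rfl⟩, hy,
    recutNear_recut hb₀ ⟨?_, ?_, s, hs, hzs⟩ hA hconj hP₁, hinj₁, hsep, hbent, fun hgood => ?_⟩
  · exact hG.trans (by norm_num [beta0])
  · exact hξ.trans (by norm_num [xi0])
  · exact chartBy_recut hch hinj₀ hb₀ hs hzs A hA' hb₁0 hconj hwinj hwr hwc y (compFamilyW_recut hinj₁ hsep hbent hgood)

/-- ★ **(LSᴿ-bentW)_κN `RecutLSWith κN`** [THE LEAST-SQUARES HALF of (RFᴿ-bentW) · NUMERICAL / INSTRUMENTABLE (census KAPPA-L, KAPPA-N, GOOD)] — for every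
admissible clean mono-phase cluster charted by `z₀ ∈ 𝓘₀ᴿʷ` (coarse `1/4`, fine `0 ≤ t ≤ T₀(z₀)`, labels `e₀`) there is a matrix `A` with `‖A‖ ≤ κL₀·t` (the
least-squares linear part of the deviation field, measured `≤ 0.316·t`) such that EVERY recut `(z₁, c₁, e₁)` of the chart by `A` (`RecutOf A …`, centre kept) is
`κN·t`-level-near, has an `η₃₀`-good centre, and carries the projected affine-free deviation (`projectedFree … e₁ t`: the normal equations of `A = A_LS`).  The level
constant is a PARAMETER: census KAPPA-N♭ (j346805) measured the level transport `|η(z₁) − η(z₀)| ≤ L_N·‖A‖` with `L_N = 2.13 ≈ 2(1+η)` (the `d`-pinned fit scale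
doubles it), so `κN = 1/3` is false-leaning and `κN♯ = 9/10 ≥ 2.13·κL₀` is the restated constant (`kN2` below). -/
def RecutLSWith (κN : ℝ) : Prop :=
  ∀ (M : ℕ) (z : Fin M → E3) (c : Fin M) (M₀ : ℕ) (z₀ : Fin M₀ → E3) (c₀ : Fin M₀) (e₀ : Fin M → Fin M₀) (t : ℝ),
    Admissible M z c → CleanBall (63 / 10) z c → MonoPhaseBall (63 / 10) z c → 0 ≤ t → t ≤ T0 M₀ z₀ c₀ → ChartBy ChartFamilyRW tau0 t z c z₀ c₀ e₀ →
      ∃ A : E3 →L[ℝ] E3, ‖A‖ ≤ kL0 * max t 0 ∧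
        ∀ (M₁ : ℕ) (z₁ : Fin M₁ → E3) (c₁ : Fin M₁) (e₁ : Fin M → Fin M₁), RecutOf A z₀ c₀ z₁ c₁ e₀ e₁ → z₁ c₁ = z₀ c₀ →
          LevelNear κN t z₀ c₀ z₁ c₁ ∧ GoodAtScale eta30 (3 / 2) z₁ c₁ ∧ projectedFree M z c M₁ z₁ c₁ e₁ t

/-- ★★★ **(RF)_κN FROM ITS LEAST-SQUARES HALF** — `RecutLSWith κN → AffineRecut 𝓘₀ᴿʷ 𝓘₁ʷ 𝓑₀ τ₀ τ₁ κN κL₀ T₀`: the instance half (existence, `RecutNear`,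
injectivity, separation, bentness, membership, the coarse chart `7/20`) is PROVED (`…RecutBuild`, this module) for every level constant. [folklore] -/
theorem affineRecut_of_LS {κN : ℝ} (h : RecutLSWith κN) : AffineRecut ChartFamilyRW CompFamilyW bends0 tau0 tau1 κN kL0 T0 := by
  intro M z c M₀ z₀ c₀ e₀ t hadm hclean hmono ht ht' hch
  obtain ⟨A, hA, hLS⟩ := h M z c M₀ z₀ c₀ e₀ t hadm hclean hmono ht ht' hch
  obtain ⟨M₁, z₁, c₁, e₁, hRO, hy, hRN, -, -, -, hchart⟩ := exists_chart_recut_of_chartFamilyRW hch ht ht' A hA (z₀ c₀)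
  obtain ⟨hlev, hgood, hpf⟩ := hLS M₁ z₁ c₁ e₁ hRO hy
  exact ⟨M₁, z₁, c₁, e₁, hlev, hRN, hchart hgood, hpf⟩

/-- ★★★ **(RFᴿ-bentW) FROM ITS LEAST-SQUARES HALF at the record's constant `κN₁ = 1/3`** — what the binder (RFᴿ-bentW) of `coreOff_record_g54W_T2` still
imports is exactly (LSᴿ-bentW)_{1/3}. [folklore] -/
theorem recutBentW_of_LS (h : RecutLSWith kN1) : RecutBentW := affineRecut_of_LS h

/-- THE RESTATED LEVEL CONSTANT `κN♯ = 9/10` [NUMERICAL — census KAPPA-N♭ j346805: `L_N = 2.13`, `2.13·κL₀ = 0.852 ≤ 9/10`; with the measured `‖A_LS‖ ≤ 0.316·t`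
the level shift is `≤ 0.68·t`]. -/
noncomputable def kN2 : ℝ := 9 / 10

/-- ★ **(LSᴿ♯-bentW) `RecutLSW := RecutLSWith κN♯`** — the least-squares half AS RESTATED (level window `±(9/10)·t`); the designate binder for the next record,
through `affineRecut_of_LS : RecutLSW → AffineRecut 𝓘₀ᴿʷ 𝓘₁ʷ 𝓑₀ τ₀ τ₁ κN♯ κL₀ T₀` (the domination tables are then read on the level window `±κN♯·t`). -/
def RecutLSW : Prop := RecutLSWith kN2

/-- (RFᴿ♯-bentW) from (LSᴿ♯-bentW). [formal bookkeeping] -/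
theorem affineRecutW_of_LSW (h : RecutLSW) : AffineRecut ChartFamilyRW CompFamilyW bends0 tau0 tau1 kN2 kL0 T0 := affineRecut_of_LS h

end Summit.AtomisticToContinuum.Crystallization.Theorems.FrustratedLawDichotomyStrainedPatchRecutChart
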